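import Summits.HodgeConjecture.HodgeConjecture.Theorems.K2E3CayleySliceConjugatesNhdsField        -- ★ p855392 (this seat): (S-d) over a field
import Summits.HodgeConjecture.HodgeConjecture.Theorems.K2E3SemisimpleMatrixRingEquivTransfer     -- ★ p855418 (this seat): semisimplicity along a ring iso
import Summits.HodgeConjecture.HodgeConjecture.Theorems.K2E3CayleyCharpolyDiscr                   -- ★ p855189 (this seat): `map_nonsing_inv_of_isUnit`
import Literature.NumberTheory.Automorphic.LocalUnitaryGroupCongr                                  -- ★ `localNonsplitEquiv` (one-place model at a non-split place)
import Literature.NumberTheory.Automorphic.UnitaryGroupNonsplitPlace                               -- ★ `PlacesOver.eq_of_smul_eq`, `PlacesOver.galInv_eq_self_of_smul_eq`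
import Literature.NumberTheory.Automorphic.AdelicUnitaryGroupDatum                                 -- ★ `UnitaryGroup.cmDatum`
import HarnessLib

/-!
# K2 · E3 ∕ U12-d, road (S-d) file 3b (NON-SPLIT places) — sub-socket (S-d) on the socket's own carrier `(cmDatum L N H).Local v` at a place `v` of `L⁺`
# that does not split in `L`: transport of ★ `exists_nhds_conj_mem_cayleySlice` through the one-place model `U_N(H)(L⁺_v) ≃ₜ* U(σ_w, H_w)(L_w)`

HCML Track B «K2-LIT», cell `pub/hodgecm-mathlib`, crux H413 = `stmt-HodgeConjecture-24833` (`--supports … --as helper`), seat `hodgecm-mathlib-K2E3-p12` (g0),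
socket #12 `sig_K2E3NormalizedCharBddNearSemisimple`, sub-socket (S-d) = U12-d₂ `…K2E3EllipticInputs.U12Characters.sig_K2E3CayleySliceConjugatesNhds` (SIGS ED. 3 afcbd7452724;
my SUBSIGS 8fea84bcf8bff209 verbatim).
At a NON-SPLIT place (`w ∣ v`, `w̄ = w`) the coefficient ring `R = L ⊗ L⁺_v = Π_{w′∣v} L_{w′}` has the single factor `L_w` (★ `PlacesOver.eq_of_smul_eq`), evaluation at
`w` is a ring isomorphism and a homeomorphism `R ≃ L_w` (Mathlib `RingEquiv.piUnique` ∕ `Homeomorph.piUnique` on the `Unique` fibre), under which `conjLocal ↦ σ_w =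
galAdicCompletionMap`, `J_v ↦ H_w = placeForm H w` (★ `localForm_map_eval`), `U_N(H)(L⁺_v) ↦ U(σ_w, H_w)(L_w)` (★ `localNonsplitEquiv`, matrices = `w`-components), and
semisimplicity is preserved (★ `isSemisimple_toLin'_map_ringEquiv`).  **`cayleySliceConjugatesNhds_of_nonsplit`**: the (S-d) clauses VERBATIM (conjugator `x`, slice
parameter `Y ∈ V`) for `(cmDatum L N H).Local v`, `v` non-split — pulled back from ★ `exists_nhds_conj_mem_cayleySlice` over the complete field `L_w` (char 0).
The SPLIT places (`G ≃ GL_N(L_w)`, ★ `localSplitEquiv`) are the remaining half of file 3b.  [HarishChandra1999 §18 p. 79]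
THEOREMS ONLY; no `sorry`; axioms ⊆ the trio.  HONEST LABEL: HC_CM is proved only modulo the 7 printed citations (2 remaining named inputs: hLiu418 =
stmt-HodgeConjecture-24832, h413 = stmt-HodgeConjecture-24833) until rung 0 closes.

## References
* [HarishChandra1999AdmissibleDistributions] Harish-Chandra (DeBacker–Sally), *Admissible Invariant Distributions on Reductive p-adic Groups* (1999), §18 p. 79.
* [PlatonovRapinchuk1994] V. Platonov, A. Rapinchuk, *Algebraic Groups and Number Theory* (1994), §5.1 (one-place models), §2.3.
* [CasselsFrohlichANT1967] J. W. S. Cassels, A. Fröhlich (eds.), *Algebraic Number Theory* (1967), Ch. II §10 (`L ⊗ K_v = Π L_w`).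
-/

set_option autoImplicit false
set_option linter.dupNamespace false

noncomputable section

open Filter Topology Set NumberField IsDedekindDomain
open scoped Matrix MatrixGroups Matrix.Norms.Operator
open Literature.NumberTheory.Automorphic Literature.NumberTheory.Automorphic.UnitaryGroup
open Summit.HodgeConjecture.HodgeConjecture.Cruxes.H413.K2E3CayleySliceConjugatesNhdsField
open Summit.HodgeConjecture.HodgeConjecture.Cruxes.H413.K2E3SemisimpleMatrixRingEquivTransfer

namespace Summit.HodgeConjecture.HodgeConjecture.Cruxes.H413.K2E3CayleySliceConjugatesNhdsNonsplit

variable (L : Type) [Field L] [NumberField L] [IsCMField L] (N : ℕ) (H : Matrix (Fin N) (Fin N) L)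
  (v : HeightOneSpectrum (𝓞 ↥(maximalRealSubfield L)))

/-- At a non-split place, the `w`-component of `Y.map conjLocal` is `σ_w` of the `w`-component of `Y` (`σ_w = galAdicCompletionMap c hw`; the place
`c⁻¹•w` over which `conjLocal` reads its argument IS `w`, ★ `PlacesOver.eq_of_smul_eq`). [cite: CasselsFrohlichANT1967, Ch. II §10] -/
theorem map_conjLocal_map_eval_of_smul_eq (w : UnitaryGroup.PlacesOver L v) (hw : IsCMField.complexConj L • w.1 = w.1) (Y : Matrix (Fin N) (Fin N) (UnitaryGroup.LocalRing L v)) :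
    (Y.map (UnitaryGroup.conjLocal L (IsCMField.complexConj L) v)).map (Pi.evalRingHom (fun w' : UnitaryGroup.PlacesOver L v => w'.1.adicCompletion L) w) =
      (Y.map (Pi.evalRingHom (fun w' : UnitaryGroup.PlacesOver L v => w'.1.adicCompletion L) w)).map (galAdicCompletionMap (L := L) (IsCMField.complexConj L) hw) := by
  have hc : IsCMField.complexConj L ≠ 1 := IsCMField.complexConj_ne_one L
  have key : ∀ (w₁ : UnitaryGroup.PlacesOver L v) (h₁ : IsCMField.complexConj L • w₁.1 = w.1) (x : UnitaryGroup.LocalRing L v),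
      galAdicCompletionMap (L := L) (IsCMField.complexConj L) h₁ (x w₁) = galAdicCompletionMap (L := L) (IsCMField.complexConj L) hw (x w) := by
    intro w₁ h₁ x
    obtain rfl : w₁ = w := UnitaryGroup.PlacesOver.eq_of_smul_eq (IsCMField.complexConj L) hc w hw w₁
    rfl
  refine Matrix.ext fun i j => ?_
  rw [Matrix.map_apply, Matrix.map_apply, Matrix.map_apply, Matrix.map_apply, Pi.evalRingHom_apply, Pi.evalRingHom_apply,
    UnitaryGroup.conjLocal_apply]
  exact key (UnitaryGroup.PlacesOver.galInv (IsCMField.complexConj L) w) (smul_inv_smul (IsCMField.complexConj L) w.1) (Y i j)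

set_option maxHeartbeats 800000 in -- one long transport proof (≈ 3× the default budget): every clause is moved across the one-place model by explicit rewrites
/-- **(S-d) at a NON-SPLIT place, on the socket's carrier.**  `v` a finite place of `L⁺` with a place `w` of `L` above it fixed by complex conjugation; `s ∈ U_N(H)(L⁺_v)`
with semisimple matrix; `V` a neighbourhood of `0` in `M_N(L ⊗ L⁺_v)`.  Then there is an open `U ∋ s` such that every `g ∈ U` is conjugate, by some `x ∈ U_N(H)(L⁺_v)`, to
`s·(1+Y)(1−Y)⁻¹` with `Y ∈ V` skew (`(σY)ᵀJ_v = −J_vY`), commuting with `s`, `1 ± Y` units — the clauses of U12-d₂ `sig_K2E3CayleySliceConjugatesNhds` verbatim.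
[cite: HarishChandra1999AdmissibleDistributions, §18 p. 79] [cite: PlatonovRapinchuk1994, §5.1] -/
theorem cayleySliceConjugatesNhds_of_nonsplit (hHd : H.det ≠ 0)
    (w : UnitaryGroup.PlacesOver L v) (hw : IsCMField.complexConj L • w.1 = w.1)
    (s : (UnitaryGroup.cmDatum L N H).Local v) (hs : Module.End.IsSemisimple (Matrix.toLin' ((s.val : GL (Fin N) (UnitaryGroup.LocalRing L v)).val : Matrix (Fin N) (Fin N) (UnitaryGroup.LocalRing L v))))
    (V : Set (Matrix (Fin N) (Fin N) (UnitaryGroup.LocalRing L v))) (hV : V ∈ 𝓝 (0 : Matrix (Fin N) (Fin N) (UnitaryGroup.LocalRing L v))) :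
    ∃ U : Set ((UnitaryGroup.cmDatum L N H).Local v), IsOpen U ∧ s ∈ U ∧
      ∀ g ∈ U, ∃ x : (UnitaryGroup.cmDatum L N H).Local v, ∃ Y ∈ V,
        (Y.map (UnitaryGroup.conjLocal L (IsCMField.complexConj L) v))ᵀ * ((UnitaryGroup.adelicForm L N H).map (UnitaryGroup.adeleToLocal L v)) = -(((UnitaryGroup.adelicForm L N H).map (UnitaryGroup.adeleToLocal L v)) * Y) ∧
        ((s.val : GL (Fin N) (UnitaryGroup.LocalRing L v)).val : Matrix (Fin N) (Fin N) (UnitaryGroup.LocalRing L v)) * Y = Y * ((s.val : GL (Fin N) (UnitaryGroup.LocalRing L v)).val : Matrix (Fin N) (Fin N) (UnitaryGroup.LocalRing L v)) ∧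
        IsUnit (1 - Y) ∧ IsUnit (1 + Y) ∧
        (((x * g * x⁻¹).val : GL (Fin N) (UnitaryGroup.LocalRing L v)).val : Matrix (Fin N) (Fin N) (UnitaryGroup.LocalRing L v)) = ((s.val : GL (Fin N) (UnitaryGroup.LocalRing L v)).val : Matrix (Fin N) (Fin N) (UnitaryGroup.LocalRing L v)) * ((1 + Y) * (1 - Y)⁻¹) := by
  classical
  -- `L_w` as a complete non-trivially normed field of characteristic zero (Mathlib `Valued.toNontriviallyNormedField`)
  letI : NontriviallyNormedField (w.1.adicCompletion L) := Valued.toNontriviallyNormedField (w.1.adicCompletion L) (WithZero (Multiplicative ℤ))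
  haveI : CharZero (w.1.adicCompletion L) := charZero_of_injective_algebraMap (algebraMap L (w.1.adicCompletion L)).injective
  have hc : IsCMField.complexConj L ≠ 1 := IsCMField.complexConj_ne_one L
  -- the fibre over `v` is the single place `w`
  letI : Unique (UnitaryGroup.PlacesOver L v) := ⟨⟨w⟩, fun w' => UnitaryGroup.PlacesOver.eq_of_smul_eq (IsCMField.complexConj L) hc w hw w'⟩
  -- evaluation at `w`: ring isomorphism and homeomorphism `R ≃ L_w` (same underlying functions)
  set ψ : UnitaryGroup.LocalRing L v ≃+* (w.1.adicCompletion L) := RingEquiv.piUnique (fun w' : UnitaryGroup.PlacesOver L v => w'.1.adicCompletion L) with hψ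
  set ψₜ : UnitaryGroup.LocalRing L v ≃ₜ (w.1.adicCompletion L) := Homeomorph.piUnique (fun w' : UnitaryGroup.PlacesOver L v => w'.1.adicCompletion L) with hψₜ
  have hψev : ((ψ : UnitaryGroup.LocalRing L v →+* (w.1.adicCompletion L)) : UnitaryGroup.LocalRing L v → (w.1.adicCompletion L)) = (Pi.evalRingHom (fun w' : UnitaryGroup.PlacesOver L v => w'.1.adicCompletion L) w) := rfl
  -- field-model data at `w`
  set σw := galAdicCompletionMap (L := L) (IsCMField.complexConj L) hw with hσw
  have hσwc : Continuous σw := continuous_galAdicCompletionMap (L := L) (IsCMField.complexConj L) hw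
  have hJw : IsUnit (UnitaryGroup.placeForm H w.1).det :=
    (Matrix.isUnit_iff_isUnit_det _).1 (UnitaryGroup.isUnit_placeForm_of_isUnit_det (isUnit_iff_ne_zero.2 hHd) w.1)
  -- the one-place model and its action on matrices (componentwise evaluation at `w`)
  set e := UnitaryGroup.localNonsplitEquiv (IsCMField.complexConj L) H hc w hw with he
  have hemat : ∀ g : (UnitaryGroup.cmDatum L N H).Local v, (((e g : unitaryGroupOfForm σw (UnitaryGroup.placeForm H w.1)) : GL (Fin N) (w.1.adicCompletion L)) : Matrix (Fin N) (Fin N) (w.1.adicCompletion L)) =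
      ((g.val : GL (Fin N) (UnitaryGroup.LocalRing L v)).val : Matrix (Fin N) (Fin N) (UnitaryGroup.LocalRing L v)).map (Pi.evalRingHom (fun w' : UnitaryGroup.PlacesOver L v => w'.1.adicCompletion L) w) := by
    intro g
    rw [he, UnitaryGroup.localNonsplitEquiv, ContinuousMulEquiv.trans_apply, UnitaryGroup.coe_localPiNonsplitEquiv_apply,
      UnitaryGroup.coe_localPiEquiv_symm_apply, GLn.coe_piEquiv_apply]
  -- semisimplicity of `s_w`
  have hss : Module.End.IsSemisimple (Matrix.toLin' ((((e s : unitaryGroupOfForm σw (UnitaryGroup.placeForm H w.1)) : GL (Fin N) (w.1.adicCompletion L)) :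
      Matrix (Fin N) (Fin N) (w.1.adicCompletion L)))) := by
    rw [hemat, ← hψev]
    exact isSemisimple_toLin'_map_ringEquiv ψ _ hs
  -- the pulled-back neighbourhood `V' = {Y' | Y'.map ψ⁻¹ ∈ V}`
  have hcs : Continuous fun Y' : Matrix (Fin N) (Fin N) (w.1.adicCompletion L) => Y'.map ψₜ.symm :=
    Continuous.matrix_map continuous_id ψₜ.symm.continuous
  have hψ0 : ψₜ.symm 0 = 0 := by
    apply ψₜ.injective
    rw [ψₜ.apply_symm_apply]
    rfl
  have hV' : (fun Y' : Matrix (Fin N) (Fin N) (w.1.adicCompletion L) => Y'.map ψₜ.symm) ⁻¹' V ∈ 𝓝 (0 : Matrix (Fin N) (Fin N) (w.1.adicCompletion L)) := by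
    refine hcs.continuousAt.preimage_mem_nhds ?_
    have h0 : (0 : Matrix (Fin N) (Fin N) (w.1.adicCompletion L)).map ψₜ.symm = 0 := by
      ext i j; simp only [Matrix.map_apply, Matrix.zero_apply, hψ0]
    rw [h0]; exact hV
  obtain ⟨U', hU'o, hsU', hmain⟩ := exists_nhds_conj_mem_cayleySlice σw hσwc hJw
    ((e s : unitaryGroupOfForm σw (UnitaryGroup.placeForm H w.1)) : GL (Fin N) (w.1.adicCompletion L)) (e s).2 hss _ hV'
  -- the open set on `G`: preimage of `U'` under `g ↦ MAT(g)_w`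
  have hcont : Continuous fun g : (UnitaryGroup.cmDatum L N H).Local v => ((g.val : GL (Fin N) (UnitaryGroup.LocalRing L v)).val : Matrix (Fin N) (Fin N) (UnitaryGroup.LocalRing L v)).map (Pi.evalRingHom (fun w' : UnitaryGroup.PlacesOver L v => w'.1.adicCompletion L) w) :=
    (Units.continuous_val.comp continuous_subtype_val).matrix_map (continuous_apply w)
  refine ⟨(fun g : (UnitaryGroup.cmDatum L N H).Local v => ((g.val : GL (Fin N) (UnitaryGroup.LocalRing L v)).val : Matrix (Fin N) (Fin N) (UnitaryGroup.LocalRing L v)).map (Pi.evalRingHom (fun w' : UnitaryGroup.PlacesOver L v => w'.1.adicCompletion L) w)) ⁻¹' U', hU'o.preimage hcont, ?_, fun g hg => ?_⟩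
  · rw [Set.mem_preimage, ← hemat]; exact hsU'
  · obtain ⟨x', hx'U, Y', hY'V, hskew, hcomm, h1, h2, hconj⟩ :=
      hmain ((e g : unitaryGroupOfForm σw (UnitaryGroup.placeForm H w.1)) : GL (Fin N) (w.1.adicCompletion L)) (e g).2 (by rw [hemat]; exact hg)
    obtain ⟨x, hx⟩ : ∃ x : (UnitaryGroup.cmDatum L N H).Local v, x = e.symm ⟨x', hx'U⟩ := ⟨_, rfl⟩
    obtain ⟨Y, hY⟩ : ∃ Y : Matrix (Fin N) (Fin N) (UnitaryGroup.LocalRing L v), Y = Y'.map ψₜ.symm := ⟨_, rfl⟩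
    have hYV : Y ∈ V := by rw [hY]; exact hY'V
    have hYw : Y.map (Pi.evalRingHom (fun w' : UnitaryGroup.PlacesOver L v => w'.1.adicCompletion L) w) = Y' := by
      rw [hY, Matrix.map_map]
      exact Matrix.ext fun i j => ψₜ.apply_symm_apply (Y' i j)
    -- injectivity of evaluation at `w` on matrices over `R`
    have hinj : ∀ M M' : Matrix (Fin N) (Fin N) (UnitaryGroup.LocalRing L v), M.map (Pi.evalRingHom (fun w' : UnitaryGroup.PlacesOver L v => w'.1.adicCompletion L) w) = M'.map (Pi.evalRingHom (fun w' : UnitaryGroup.PlacesOver L v => w'.1.adicCompletion L) w) → M = M' := by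
      intro M M' h
      rw [Matrix.eq_iff_forall_map_evalRingHom]
      intro w'
      obtain rfl : w' = w := UnitaryGroup.PlacesOver.eq_of_smul_eq (IsCMField.complexConj L) hc w hw w'
      exact h
    -- units transfer along the ring isomorphism `ψ.mapMatrix`
    have hunit : ∀ M : Matrix (Fin N) (Fin N) (UnitaryGroup.LocalRing L v), IsUnit (M.map (Pi.evalRingHom (fun w' : UnitaryGroup.PlacesOver L v => w'.1.adicCompletion L) w)) → IsUnit M := by
      intro M hM
      have hM' : IsUnit (ψ.mapMatrix M) := by rw [RingEquiv.mapMatrix_apply]; exact hM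
      exact (isUnit_map_iff (ψ.mapMatrix : Matrix (Fin N) (Fin N) (UnitaryGroup.LocalRing L v) ≃+* Matrix (Fin N) (Fin N) (w.1.adicCompletion L)) M).1 hM'
    have h1R : IsUnit (1 - Y) := hunit _ (by rw [Matrix.map_sub _ (map_sub _), Matrix.map_one _ (map_zero _) (map_one _), hYw]; exact h1)
    have h2R : IsUnit (1 + Y) := hunit _ (by rw [Matrix.map_add _ (map_add _), Matrix.map_one _ (map_zero _) (map_one _), hYw]; exact h2)
    refine ⟨x, Y, hYV, ?_, ?_, h1R, h2R, ?_⟩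
    · -- skewness, checked at `w`
      apply hinj
      rw [Matrix.map_mul, Matrix.transpose_map, map_conjLocal_map_eval_of_smul_eq L N v w hw, hYw, UnitaryGroup.localForm_map_eval,
        Matrix.map_neg _ (map_neg _), Matrix.map_mul, UnitaryGroup.localForm_map_eval, hYw]
      exact hskew
    · -- commutes with `s`, checked at `w`
      apply hinj
      rw [Matrix.map_mul, Matrix.map_mul, hYw, ← hemat]
      exact hcomm
    · -- the conjugation identity, checked at `w`
      apply hinj
      -- `GL_N` of evaluation at `w` is a monoid hom carrying `x ↦ x'`, `g ↦ e g`
      have hGLmap : ∀ u : GL (Fin N) (UnitaryGroup.LocalRing L v),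
          ((Matrix.GeneralLinearGroup.map (Pi.evalRingHom (fun w' : UnitaryGroup.PlacesOver L v => w'.1.adicCompletion L) w) u : GL (Fin N) (w.1.adicCompletion L)) :
              Matrix (Fin N) (Fin N) (w.1.adicCompletion L)) =
            (u : Matrix (Fin N) (Fin N) (UnitaryGroup.LocalRing L v)).map (Pi.evalRingHom (fun w' : UnitaryGroup.PlacesOver L v => w'.1.adicCompletion L) w) :=
        fun u => rfl
      have hex : (((e x : unitaryGroupOfForm σw (UnitaryGroup.placeForm H w.1)) : GL (Fin N) (w.1.adicCompletion L)) : Matrix (Fin N) (Fin N) (w.1.adicCompletion L)) = x' := by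
        rw [hx, ContinuousMulEquiv.apply_symm_apply]
      have hGx : Matrix.GeneralLinearGroup.map (Pi.evalRingHom (fun w' : UnitaryGroup.PlacesOver L v => w'.1.adicCompletion L) w) (x.val : GL (Fin N) (UnitaryGroup.LocalRing L v)) = x' :=
        Units.ext (by rw [hGLmap, ← hemat x, hex])
      have hGg : Matrix.GeneralLinearGroup.map (Pi.evalRingHom (fun w' : UnitaryGroup.PlacesOver L v => w'.1.adicCompletion L) w) (g.val : GL (Fin N) (UnitaryGroup.LocalRing L v)) =
          ((e g : unitaryGroupOfForm σw (UnitaryGroup.placeForm H w.1)) : GL (Fin N) (w.1.adicCompletion L)) :=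
        Units.ext (by rw [hGLmap, ← hemat g])
      have hxgx : ((((x * g * x⁻¹ : (UnitaryGroup.cmDatum L N H).Local v)).val : GL (Fin N) (UnitaryGroup.LocalRing L v)).val : Matrix (Fin N) (Fin N) (UnitaryGroup.LocalRing L v)).map (Pi.evalRingHom (fun w' : UnitaryGroup.PlacesOver L v => w'.1.adicCompletion L) w) =
          ((x' * ((e g : unitaryGroupOfForm σw (UnitaryGroup.placeForm H w.1)) : GL (Fin N) (w.1.adicCompletion L)) * x'⁻¹ : GL (Fin N) (w.1.adicCompletion L)) : Matrix (Fin N) (Fin N) (w.1.adicCompletion L)) := by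
        rw [show ((x * g * x⁻¹ : (UnitaryGroup.cmDatum L N H).Local v).val : GL (Fin N) (UnitaryGroup.LocalRing L v)) = x.val * g.val * x.val⁻¹ from rfl,
          ← hGLmap, map_mul, map_mul, map_inv, hGx, hGg]
      rw [hxgx, Matrix.map_mul, Matrix.map_mul, ← hemat s, Matrix.map_add _ (map_add _), Matrix.map_one _ (map_zero _) (map_one _), hYw,
        Summit.HodgeConjecture.HodgeConjecture.Cruxes.H413.K2E3CayleyCharpolyDiscr.map_nonsing_inv_of_isUnit _ (1 - Y)
          ((Matrix.isUnit_iff_isUnit_det _).1 h1R),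
        Matrix.map_sub _ (map_sub _), Matrix.map_one _ (map_zero _) (map_one _), hYw]
      exact hconj

end Summit.HodgeConjecture.HodgeConjecture.Cruxes.H413.K2E3CayleySliceConjugatesNhdsNonsplit

end
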